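import Literature.NumberTheory.EllipticCurves.IwasawaLambdaNorm
import Summits.BirchSwinnertonDyer.Rank1Residual.X1.MuLambdaAlgebra
import Literature.NumberTheory.EllipticCurves.PAdicBSD
import Literature.NumberTheory.EllipticCurves.GreenbergVatsal2000.CongruentCurves
import Mathlib.RingTheory.PowerSeries.Order
import Mathlib.RingTheory.PowerSeries.NoZeroDivisors
import Mathlib.Analysis.Normed.Field.Basic
import Mathlib.NumberTheory.Padics.PadicIntegers
import Mathlib.RingTheory.LocalRing.ResidueField.Basic
import HarnessLib

/-!
# API of the valued `λ`-invariant `normLam` (class X11a, GL₂ vocabulary item (V-inv), API part)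
# (cell `b2b-bsdres`, unit `b2b-bsdres-x11a`, gen 15)

HONEST FRAMING (run/shared/lean/b2b/bsd-rank1-residual/, verbatim in every file): the goal of the
cell is to DELETE the COMBINATION-SHAPED residual classes of the Birch–Swinnerton-Dyer formula for
ALL analytic-rank `≤ 1` elliptic curves over `ℚ` — "full BSD formula for every rank `≤ 1` curve in
class `C`" assembled STRICTLY from published theorems — so that the rank-`≤ 1` remainder becomes
exactly the CONSTRUCTION-SHAPED classes, which are TYPED (missing-input `Prop`s), NOT attempted.
This is not "finishing BSD". Research route; NO CLAIM BEYOND STATED CLASSES. No definition, no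
named fact: theorems only (Mathlib + the Literature definitions `IsMaxCoeffAt` / `HasMaxCoeff` /
`normLam` of `Literature/NumberTheory/EllipticCurves/IwasawaLambdaNorm.lean` + eisenstein-p1's
`X1.MuLambda.lam`).

Purpose. The X11a chain (HOME/b2b-bsdres-x11a/X11A-CHAIN.md, lit audit PASS as a candidate) compares
the `λ`-invariants of an elliptic curve at a multiplicative prime `p` (elements of `Λ = ℤ_p⟦T⟧`,
measured in the tree by `X1.MuLambda.lam`) with those of a good-ordinary higher-weight member of
its Hida family (`𝒪`-coefficients, `𝒪 ⊋ ℤ_p` in general), via Emerton–Pollack–Weston 2006 Thm. 2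
and X. Wan 2015 Thm. 4. The common currency is `normLam` (least index of a coefficient of maximal
norm; scale-invariant). This file proves its API:

* general (seminormed ring): `isMaxCoeffAt_normLam`, `normLam_le_of_isMaxCoeffAt`,
  `norm_coeff_lt_of_lt_normLam`, `normLam_eq_iff`; transport `normLam_map` along norm-preserving
  ring maps (`ℤ_p ↪ ℚ_p ↪ ℚ̄_p`, `𝒪 ↪ L`); scaling `normLam_C_mul` (`‖c‖ ≠ 0`: the period / the
  generator / `π^a` do not matter); shift `normLam_X_mul` (`λ(T·F) = λ(F) + 1`, the trivial-zero
  factor at a split multiplicative prime);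
* over `ℤ_p` with unit content (`∃ n, ‖aₙ‖ = 1`, i.e. `μ = 0`): `normLam F = ord_T(F mod p)`
  (`normLam_eq_order_toNat`, Washington §7.1), additivity `normLam_mul`, insensitivity to unit
  multiples `normLam_mul_of_norm_constantCoeff_eq_one`, and **the bridge to the cell's `λ`**:
  `lam_eq_normLam : HasUnitContent F → X1.MuLambda.lam F = normLam F`,
  `normLam_iwasawaToPowerSeries`.

References: [Washington1997] §7.1; [GreenbergVatsal2000] (1)–(2); [EmertonPollackWeston2006] §3.1,
Thm. 2; HOME/b2b-bsdres-x11a/GL2-VOCAB-SPEC.md (V-inv).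
-/

noncomputable section

open scoped Classical

open Literature.NumberTheory.EllipticCurves
  Literature.NumberTheory.EllipticCurves.GreenbergVatsal2000

set_option autoImplicit false

namespace Summit.BirchSwinnertonDyer.Rank1Residual.X11a.LambdaNorm

/-! ### General seminormed ring -/

section General

variable {R : Type*} [SeminormedRing R]

/-- If the maximum is attained, it is attained at the index `normLam F`. [folklore] -/
theorem isMaxCoeffAt_normLam {F : PowerSeries R} (h : HasMaxCoeff F) :
    IsMaxCoeffAt F (normLam F) :=
  Nat.sInf_mem h

/-- `normLam F` is at most any index of maximal norm. [folklore] -/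
theorem normLam_le_of_isMaxCoeffAt {F : PowerSeries R} {n : ℕ} (h : IsMaxCoeffAt F n) :
    normLam F ≤ n :=
  Nat.sInf_le h

/-- Junk value: `normLam F = 0` when no coefficient has maximal norm. [folklore] -/
theorem normLam_eq_zero_of_not_hasMaxCoeff {F : PowerSeries R} (h : ¬ HasMaxCoeff F) :
    normLam F = 0 := by
  rw [normLam, Nat.sInf_eq_zero]
  right
  ext n
  simp only [Set.mem_setOf_eq, Set.mem_empty_iff_false, iff_false]
  exact fun hn => h ⟨n, hn⟩

/-- Coefficients before the index `normLam F` have strictly smaller norm. [folklore] -/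
theorem norm_coeff_lt_of_lt_normLam {F : PowerSeries R} {m : ℕ} (hm : m < normLam F) :
    ‖PowerSeries.coeff m F‖ < ‖PowerSeries.coeff (normLam F) F‖ := by
  by_cases h : HasMaxCoeff F
  · by_contra hle
    rw [not_lt] at hle
    have hmax : IsMaxCoeffAt F m := fun m' => (isMaxCoeffAt_normLam h m').trans hle
    exact absurd (normLam_le_of_isMaxCoeffAt hmax) (not_le.mpr hm)
  · rw [normLam_eq_zero_of_not_hasMaxCoeff h] at hm
    exact absurd hm (Nat.not_lt_zero m)

/-- Characterisation: `normLam F = n` iff `n` is an index of maximal norm and all earlier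
coefficients are strictly smaller. [folklore] -/
theorem normLam_eq_iff {F : PowerSeries R} (h : HasMaxCoeff F) (n : ℕ) :
    normLam F = n ↔ IsMaxCoeffAt F n ∧
      ∀ m < n, ‖PowerSeries.coeff m F‖ < ‖PowerSeries.coeff n F‖ := by
  constructor
  · rintro rfl
    exact ⟨isMaxCoeffAt_normLam h, fun m hm => norm_coeff_lt_of_lt_normLam hm⟩
  · rintro ⟨hn, hlt⟩
    refine le_antisymm (normLam_le_of_isMaxCoeffAt hn) ?_
    by_contra hlt'
    rw [not_le] at hlt'
    exact absurd (isMaxCoeffAt_normLam h n) (not_le.mpr (hlt _ hlt'))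

/-- The coefficient at `normLam F` is non-zero in norm as soon as some coefficient is. [folklore] -/
theorem norm_coeff_normLam_pos {F : PowerSeries R} (h : HasMaxCoeff F)
    (h0 : ∃ n, ‖PowerSeries.coeff n F‖ ≠ 0) : 0 < ‖PowerSeries.coeff (normLam F) F‖ := by
  obtain ⟨n, hn⟩ := h0
  exact lt_of_lt_of_le (lt_of_le_of_ne (norm_nonneg _) (Ne.symm hn)) (isMaxCoeffAt_normLam h n)

end General

/-! ### Transport along norm-preserving ring maps and scaling -/

section Transport

variable {R S : Type*} [SeminormedRing R] [SeminormedRing S]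

/-- A norm-preserving ring map preserves the indices of maximal norm. [folklore] -/
theorem isMaxCoeffAt_map_iff (φ : R →+* S) (hφ : ∀ x, ‖φ x‖ = ‖x‖) (F : PowerSeries R) (n : ℕ) :
    IsMaxCoeffAt (PowerSeries.map φ F) n ↔ IsMaxCoeffAt F n := by
  simp only [IsMaxCoeffAt, PowerSeries.coeff_map, hφ]

/-- A norm-preserving ring map preserves attainment of the maximum. [folklore] -/
theorem hasMaxCoeff_map_iff (φ : R →+* S) (hφ : ∀ x, ‖φ x‖ = ‖x‖) (F : PowerSeries R) :
    HasMaxCoeff (PowerSeries.map φ F) ↔ HasMaxCoeff F := by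
  simp only [HasMaxCoeff, isMaxCoeffAt_map_iff φ hφ]

/-- **`λ` is transported by norm-preserving ring maps** (`ℤ_p ↪ ℚ_p`, `𝒪 ↪ L ↪ ℚ̄_p`). [folklore] -/
theorem normLam_map (φ : R →+* S) (hφ : ∀ x, ‖φ x‖ = ‖x‖) (F : PowerSeries R) :
    normLam (PowerSeries.map φ F) = normLam F := by
  simp only [normLam, isMaxCoeffAt_map_iff φ hφ]

variable [NormMulClass R]

/-- Scaling by a constant of non-zero norm preserves the indices of maximal norm. [folklore] -/
theorem isMaxCoeffAt_C_mul_iff {c : R} (hc : ‖c‖ ≠ 0) (F : PowerSeries R) (n : ℕ) :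
    IsMaxCoeffAt (PowerSeries.C c * F) n ↔ IsMaxCoeffAt F n := by
  have hc' : 0 < ‖c‖ := lt_of_le_of_ne (norm_nonneg c) (Ne.symm hc)
  simp only [IsMaxCoeffAt, PowerSeries.coeff_C_mul, norm_mul]
  exact forall_congr' fun m => mul_le_mul_iff_of_pos_left hc'

/-- **`λ` is scale-invariant**: `λ(c·F) = λ(F)` for a constant `c` of non-zero norm — the
`λ`-invariant of a `p`-adic `L`-function does not depend on the period, that of a characteristic
power series not on the generator, and `λ(π^a F) = λ(F)`. [cite: Washington1997, §7.1] -/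
theorem normLam_C_mul {c : R} (hc : ‖c‖ ≠ 0) (F : PowerSeries R) :
    normLam (PowerSeries.C c * F) = normLam F := by
  simp only [normLam, isMaxCoeffAt_C_mul_iff hc]

/-- Scaling preserves attainment of the maximum. [folklore] -/
theorem hasMaxCoeff_C_mul_iff {c : R} (hc : ‖c‖ ≠ 0) (F : PowerSeries R) :
    HasMaxCoeff (PowerSeries.C c * F) ↔ HasMaxCoeff F := by
  simp only [HasMaxCoeff, isMaxCoeffAt_C_mul_iff hc]

end Transport

/-! ### Multiplication by `T` -/

section Shift

variable {R : Type*} [SeminormedRing R]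

/-- The indices of maximal norm of `T·F` are the shifts of those of `F`. [folklore] -/
theorem isMaxCoeffAt_X_mul_succ_iff (F : PowerSeries R) (n : ℕ) :
    IsMaxCoeffAt (PowerSeries.X * F) (n + 1) ↔ IsMaxCoeffAt F n := by
  simp only [IsMaxCoeffAt, PowerSeries.coeff_succ_X_mul]
  constructor
  · intro h m
    have := h (m + 1)
    rwa [PowerSeries.coeff_succ_X_mul] at this
  · intro h m
    cases m with
    | zero => rw [PowerSeries.coeff_zero_X_mul, norm_zero]; exact norm_nonneg _
    | succ m => rw [PowerSeries.coeff_succ_X_mul]; exact h m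

/-- **`λ(T·F) = λ(F) + 1`** when the maximum is attained and non-zero (the trivial-zero factor
`T` at a split multiplicative prime raises `λ` by one). [cite: Washington1997, §7.1] -/
theorem normLam_X_mul {F : PowerSeries R} (h : HasMaxCoeff F)
    (h0 : ∃ n, ‖PowerSeries.coeff n F‖ ≠ 0) : normLam (PowerSeries.X * F) = normLam F + 1 := by
  have hX : HasMaxCoeff (PowerSeries.X * F) := by
    obtain ⟨n, hn⟩ := h
    exact ⟨n + 1, (isMaxCoeffAt_X_mul_succ_iff F n).mpr hn⟩
  rw [normLam_eq_iff hX]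
  refine ⟨(isMaxCoeffAt_X_mul_succ_iff F _).mpr (isMaxCoeffAt_normLam h), fun m hm => ?_⟩
  rw [PowerSeries.coeff_succ_X_mul]
  cases m with
  | zero =>
    rw [PowerSeries.coeff_zero_X_mul, norm_zero]
    exact norm_coeff_normLam_pos h h0
  | succ m =>
    rw [PowerSeries.coeff_succ_X_mul]
    exact norm_coeff_lt_of_lt_normLam (by omega)

/-- `HasMaxCoeff` is preserved by multiplication by `T`. [folklore] -/
theorem hasMaxCoeff_X_mul {F : PowerSeries R} (h : HasMaxCoeff F) :
    HasMaxCoeff (PowerSeries.X * F) := by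
  obtain ⟨n, hn⟩ := h
  exact ⟨n + 1, (isMaxCoeffAt_X_mul_succ_iff F n).mpr hn⟩

/-- `HasMaxCoeff` is preserved by multiplication by `Tᵉ`. [folklore] -/
theorem hasMaxCoeff_X_pow_mul {F : PowerSeries R} (h : HasMaxCoeff F) (e : ℕ) :
    HasMaxCoeff (PowerSeries.X ^ e * F) := by
  induction e with
  | zero => simpa using h
  | succ e ih =>
    rw [pow_succ', mul_assoc]
    exact hasMaxCoeff_X_mul ih

/-- Iterated shift: `λ(Tᵉ·F) = λ(F) + e`. [folklore] -/
theorem normLam_X_pow_mul {F : PowerSeries R} (h : HasMaxCoeff F)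
    (h0 : ∃ n, ‖PowerSeries.coeff n F‖ ≠ 0) (e : ℕ) :
    normLam (PowerSeries.X ^ e * F) = normLam F + e := by
  induction e with
  | zero => simp
  | succ e ih =>
    have h0e : ∃ n, ‖PowerSeries.coeff n (PowerSeries.X ^ e * F)‖ ≠ 0 := by
      obtain ⟨n, hn⟩ := h0
      refine ⟨n + e, ?_⟩
      rwa [PowerSeries.coeff_X_pow_mul]
    rw [pow_succ', mul_assoc, normLam_X_mul (hasMaxCoeff_X_pow_mul h e) h0e, ih, add_assoc]

end Shift

/-! ### Over `ℤ_p`: unit content, `F mod p`, additivity, and the bridge to `X1.MuLambda.lam` -/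

section PadicInt

variable {p : ℕ} [Fact p.Prime]

/-- A coefficient of `F ∈ ℤ_p⟦T⟧` reduces to `0` in `𝔽_p` iff its norm is `< 1`. [folklore] -/
theorem coeff_map_residue_eq_zero_iff (F : PowerSeries ℤ_[p]) (m : ℕ) :
    PowerSeries.coeff m (PowerSeries.map (IsLocalRing.residue ℤ_[p]) F) = 0 ↔
      ‖PowerSeries.coeff m F‖ < 1 := by
  rw [PowerSeries.coeff_map, IsLocalRing.residue_eq_zero_iff, IsLocalRing.mem_maximalIdeal,
    PadicInt.mem_nonunits]

/-- Over `ℤ_p`: `‖x‖ = 1 ↔ ¬ ‖x‖ < 1`. [folklore] -/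
theorem norm_eq_one_iff_not_lt (x : ℤ_[p]) : ‖x‖ = 1 ↔ ¬ ‖x‖ < 1 :=
  ⟨fun h => by rw [h]; exact lt_irrefl _, fun h => le_antisymm (PadicInt.norm_le_one _) (not_lt.mp h)⟩

/-- Unit content iff `F mod p ≠ 0` in `𝔽_p⟦T⟧`. [folklore] -/
theorem exists_norm_coeff_eq_one_iff_map_residue_ne_zero (F : PowerSeries ℤ_[p]) :
    (∃ n, ‖PowerSeries.coeff n F‖ = 1) ↔ PowerSeries.map (IsLocalRing.residue ℤ_[p]) F ≠ 0 := by
  rw [Ne, PowerSeries.ext_iff, not_forall]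
  refine exists_congr fun n => ?_
  rw [map_zero, coeff_map_residue_eq_zero_iff, norm_eq_one_iff_not_lt]

/-- Over `ℤ_p` a coefficient of norm `1` is one of maximal norm. [folklore] -/
theorem isMaxCoeffAt_of_norm_eq_one {F : PowerSeries ℤ_[p]} {n : ℕ}
    (hn : ‖PowerSeries.coeff n F‖ = 1) : IsMaxCoeffAt F n := fun m => by
  rw [hn]; exact PadicInt.norm_le_one _

/-- Over `ℤ_p`, unit content gives attainment of the maximum. [folklore] -/
theorem hasMaxCoeff_of_exists_norm_eq_one {F : PowerSeries ℤ_[p]}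
    (h : ∃ n, ‖PowerSeries.coeff n F‖ = 1) : HasMaxCoeff F := by
  obtain ⟨n, hn⟩ := h
  exact ⟨n, isMaxCoeffAt_of_norm_eq_one hn⟩

/-- Over `ℤ_p` with unit content, the indices of maximal norm are exactly the indices of the unit
coefficients. [folklore] -/
theorem isMaxCoeffAt_iff_norm_eq_one {F : PowerSeries ℤ_[p]}
    (h : ∃ n, ‖PowerSeries.coeff n F‖ = 1) (n : ℕ) :
    IsMaxCoeffAt F n ↔ ‖PowerSeries.coeff n F‖ = 1 := by
  obtain ⟨k, hk⟩ := h
  exact ⟨fun hn => le_antisymm (PadicInt.norm_le_one _) (hk ▸ hn k), isMaxCoeffAt_of_norm_eq_one⟩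

/-- Over `ℤ_p` with unit content, the coefficient at `normLam F` is a unit. [folklore] -/
theorem norm_coeff_normLam_eq_one {F : PowerSeries ℤ_[p]}
    (h : ∃ n, ‖PowerSeries.coeff n F‖ = 1) : ‖PowerSeries.coeff (normLam F) F‖ = 1 :=
  (isMaxCoeffAt_iff_norm_eq_one h _).mp (isMaxCoeffAt_normLam (hasMaxCoeff_of_exists_norm_eq_one h))

/-- **Over `ℤ_p` with unit content, `normLam F = ord_T (F mod p)`** — the Weierstrass degree
(Washington §7.1, Prop. 7.2 / Thm. 7.3). [cite: Washington1997, §7.1 (Prop. 7.2, Thm. 7.3)] -/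
theorem normLam_eq_order_toNat {F : PowerSeries ℤ_[p]} (h : ∃ n, ‖PowerSeries.coeff n F‖ = 1) :
    normLam F = ((PowerSeries.map (IsLocalRing.residue ℤ_[p]) F).order).toNat := by
  have h1 : ‖PowerSeries.coeff (normLam F) F‖ = 1 := norm_coeff_normLam_eq_one h
  have hord : (PowerSeries.map (IsLocalRing.residue ℤ_[p]) F).order = (normLam F : ℕ) := by
    rw [PowerSeries.order_eq_nat]
    refine ⟨fun h0 => ?_, fun m hm => (coeff_map_residue_eq_zero_iff F m).mpr ?_⟩
    · rw [coeff_map_residue_eq_zero_iff] at h0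
      exact absurd h1 (ne_of_lt h0)
    · exact h1 ▸ norm_coeff_lt_of_lt_normLam hm
  rw [hord, ENat.toNat_coe]

/-- The order of `F mod p` is finite for `F` of unit content. [folklore] -/
theorem order_map_residue_ne_top {F : PowerSeries ℤ_[p]} (h : ∃ n, ‖PowerSeries.coeff n F‖ = 1) :
    (PowerSeries.map (IsLocalRing.residue ℤ_[p]) F).order ≠ ⊤ := by
  rw [Ne, PowerSeries.order_eq_top]
  exact (exists_norm_coeff_eq_one_iff_map_residue_ne_zero F).mp h

/-- Over `ℤ_p`, unit content is preserved by products (`𝔽_p⟦T⟧` is a domain). [folklore] -/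
theorem exists_norm_coeff_mul_eq_one {F G : PowerSeries ℤ_[p]}
    (hF : ∃ n, ‖PowerSeries.coeff n F‖ = 1) (hG : ∃ n, ‖PowerSeries.coeff n G‖ = 1) :
    ∃ n, ‖PowerSeries.coeff n (F * G)‖ = 1 := by
  rw [exists_norm_coeff_eq_one_iff_map_residue_ne_zero] at hF hG ⊢
  rw [map_mul]
  exact mul_ne_zero hF hG

/-- **`λ` is additive on unit-content series over `ℤ_p`**: `λ(F·G) = λ(F) + λ(G)`.
[cite: Washington1997, §7.1] -/
theorem normLam_mul {F G : PowerSeries ℤ_[p]}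
    (hF : ∃ n, ‖PowerSeries.coeff n F‖ = 1) (hG : ∃ n, ‖PowerSeries.coeff n G‖ = 1) :
    normLam (F * G) = normLam F + normLam G := by
  rw [normLam_eq_order_toNat (exists_norm_coeff_mul_eq_one hF hG), normLam_eq_order_toNat hF,
    normLam_eq_order_toNat hG, map_mul, PowerSeries.order_mul]
  exact ENat.toNat_add (order_map_residue_ne_top hF) (order_map_residue_ne_top hG)

/-- Multiplying a unit-content series by a series with unit constant term (e.g. a unit of `Λ`)
does not change `λ`. [folklore] -/
theorem normLam_mul_of_norm_constantCoeff_eq_one {F U : PowerSeries ℤ_[p]}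
    (hF : ∃ n, ‖PowerSeries.coeff n F‖ = 1) (hU : ‖PowerSeries.constantCoeff U‖ = 1) :
    normLam (U * F) = normLam F := by
  rw [← PowerSeries.coeff_zero_eq_constantCoeff_apply] at hU
  have hU0 : normLam U = 0 :=
    Nat.eq_zero_of_le_zero (normLam_le_of_isMaxCoeffAt (isMaxCoeffAt_of_norm_eq_one hU))
  rw [normLam_mul ⟨0, hU⟩ hF, hU0, zero_add]

/-- Kato's direction in `λ`-terms: `λ(F) ≤ λ(F·G)` for unit-content series. [folklore] -/
theorem normLam_le_normLam_mul {F G : PowerSeries ℤ_[p]}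
    (hF : ∃ n, ‖PowerSeries.coeff n F‖ = 1) (hG : ∃ n, ‖PowerSeries.coeff n G‖ = 1) :
    normLam F ≤ normLam (F * G) := by
  rw [normLam_mul hF hG]; exact Nat.le_add_right _ _

/-- **Bridge to the cell's `λ`**: for `F ∈ Λ` of unit content (`μ(F) = 0`), eisenstein-p1's
`X1.MuLambda.lam F` (order of `pfree F mod p`) is `normLam F`. [folklore] -/
theorem lam_eq_normLam {F : IwasawaAlgebra p} (h : HasUnitContent F) :
    X1.MuLambda.lam F = normLam F := by
  have h' : ∃ n, ‖PowerSeries.coeff n F‖ = 1 := (hasUnitContent_iff_exists_norm_eq_one F).mp h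
  have hred : X1.MuLambda.red F ≠ 0 :=
    (exists_norm_coeff_eq_one_iff_map_residue_ne_zero F).mp h'
  have hpf : X1.MuLambda.pfree F = F :=
    (X1.MuLambda.mu_eq_and_pfree_eq (a := 0) hred (by simp)).2
  rw [X1.MuLambda.lam, hpf, normLam_eq_order_toNat h']

/-- The embedding `ι : Λ ↪ ℚ_p⟦T⟧` (`iwasawaToPowerSeries`) preserves `λ`. [folklore] -/
theorem normLam_iwasawaToPowerSeries (F : IwasawaAlgebra p) :
    normLam (iwasawaToPowerSeries p F) = normLam F :=
  normLam_map _ (fun x => by simp) F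

/-- `HasUnitContent F` gives `HasMaxCoeff` for `ι F ∈ ℚ_p⟦T⟧`, with maximal norm `1`. [folklore] -/
theorem hasMaxCoeff_iwasawaToPowerSeries {F : IwasawaAlgebra p} (h : HasUnitContent F) :
    HasMaxCoeff (iwasawaToPowerSeries p F) :=
  (hasMaxCoeff_map_iff _ (fun x => by simp) F).mpr
    (hasMaxCoeff_of_exists_norm_eq_one ((hasUnitContent_iff_exists_norm_eq_one F).mp h))

end PadicInt

end Summit.BirchSwinnertonDyer.Rank1Residual.X11a.LambdaNorm

end
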